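import Literature.RepresentationTheory.Virasoro.FockSpace
import Mathlib.Tactic.LinearCombination

/-!
# The Fock module `F_λ^μ` over the Virasoro algebra (Feigin–Fuchs / free boson)

We prove that the Feigin–Fuchs operators `L_n = ½ Σ :a_{n-j} a_j: - λ(n+1) a_n` of
`Literature.RepresentationTheory.Virasoro.FockSpace` (`Fock.L`) on the bosonic Fock space
`R[x₁, x₂, …]` (`R` a commutative `ℂ`-algebra, `λ, μ ∈ R`, `a_0 = μ`) satisfy the Virasoro
relations with central charge `c_λ = 1 - 12 λ²`:

  `[L_m, L_n] = (m - n) L_{m+n} + (c_λ / 12) (m³ - m) δ_{m+n,0}`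

(Iohara–Koga Proposition 4.1 with (4.2); `Fock.L_comm`), that the vacuum `|μ⟩ = 1` satisfies
`L_n |μ⟩ = 0` (`n > 0`), `L_0 |μ⟩ = h |μ⟩` with `h = ½ μ (μ - 2λ)` (Iohara–Koga (4.4);
`Fock.L_pos_one`, `Fock.L_zero_one`), and package the result, for `λ ∈ ℂ`, as a representation
`Fock.rep λ μ : VirasoroRep (1 - 12 λ²) (R[x₁, x₂, …])` in the sense of
`Literature.RepresentationTheory.Virasoro.VirasoroRep` (a `ℂ`-linear representation on the
underlying `ℂ`-vector space; over `R = ℂ` the vacuum is a primary vector of weight `½ μ (μ - 2λ)`,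
`Fock.isPrimary_one`).

## The proof

Following the vertex-algebra proof (Iohara–Koga §4.1.2, "one can check that this field satisfies
the following OPE") in operator language: by `Fock.lie_L_a`, `[L_n, a_j] = -j a_{n+j} + scalar`, so
the defect `C_{m,n} = [L_m, L_n] - (m-n) L_{m+n}` commutes with every `a_j` (Jacobi identity and
a two-line computation, `Fock.defect_mul_a`); an `R`-linear operator on `R[x₁, x₂, …]` commuting
with all `x_k ·` and all `∂_k` is a scalar (`Fock.eq_smul_one_of_forall_commute`, the Fock space
is an irreducible Heisenberg module, Iohara–Koga §4.1.2 "`F^η` is an irreducible `𝓗`-module");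
the scalar is read off on the vacuum: it vanishes for `m + n ≠ 0` by the `L_0`-grading, and for
`n = -m` it is `L_m L_{-m} |μ⟩ - 2m h = (c_λ/12)(m³ - m)` (`Fock.L_pos_apply_P`).

Also: `L_{-k}` (`k ≥ 1`) has no constant term (`Fock.constantCoeff_L_neg`), and the operators are
compatible with base change along `ℂ`-algebra maps `R → S` (`Fock.map_L`), used for generic-`μ`
arguments.
-/

noncomputable section

namespace Literature.RepresentationTheory.Virasoro

namespace Fock

open MvPolynomial

variable {R : Type*} [CommRing R]

/-! ### Schur's lemma for the Heisenberg action on the Fock space -/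

/-- Over a ring in which the positive integers are units, a polynomial all of whose partial
derivatives vanish is constant. [folklore] -/
theorem eq_C_of_pderiv_eq_zero (hunit : ∀ n : ℕ, 0 < n → IsUnit (n : R)) {g : Space R}
    (h : ∀ k : ℕ+, pderiv k g = 0) : g = C (coeff 0 g) := by
  ext s
  rw [coeff_C]
  split_ifs with hs
  · rw [hs]
  · obtain ⟨k, hk⟩ := Finsupp.ne_iff.mp (Ne.symm hs)
    rw [Finsupp.zero_apply] at hk
    set s' : ℕ+ →₀ ℕ := s - Finsupp.single k 1 with hs'
    have h1 := congrArg (coeff s') (h k)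
    rw [coeff_pderiv, coeff_zero, hs', Finsupp.sub_add_single_one_cancel hk] at h1
    have h2 : IsUnit (((s' k : ℕ) : R) + 1) := by
      have := hunit (s' k + 1) (Nat.succ_pos _)
      push_cast at this
      exact this
    exact (h2.mul_left_eq_zero).mp h1

/-- **Schur's lemma for the Fock space**: an `R`-linear operator on `R[x₁, x₂, …]` commuting with
all multiplications `x_k ·` and all partial derivatives `∂_k` (i.e. with the Heisenberg algebra,
`a_{-k} = x_k`, `a_k = k ∂_k`) is the scalar `⟨μ| T |μ⟩ = (T 1)(0)` — the Fock space is an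
irreducible module over the Heisenberg algebra (positive integers being units in `R`).
[cite: IoharaKoga2011, §4.1.2 ("F^η is an irreducible 𝓗-module")] -/
theorem eq_smul_one_of_forall_commute (hunit : ∀ n : ℕ, 0 < n → IsUnit (n : R))
    (T : Module.End R (Space R)) (hx : ∀ k : ℕ+, T * m (X k) = m (X k) * T)
    (hd : ∀ k : ℕ+, T * ((pderiv k : Derivation R (Space R) (Space R)) : Module.End R (Space R)) =
      ((pderiv k : Derivation R (Space R) (Space R)) : Module.End R (Space R)) * T) :
    T = coeff 0 (T 1) • (1 : Module.End R (Space R)) := by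
  have hmul : ∀ p q : Space R, T (p * q) = p * T q := by
    intro p q
    induction p using MvPolynomial.induction_on generalizing q with
    | C r => rw [C_mul', C_mul', map_smul]
    | add p₁ p₂ h₁ h₂ => rw [add_mul, map_add, h₁, h₂, add_mul]
    | mul_X p k hp =>
      have hk : T (X k * q) = X k * T q := LinearMap.congr_fun (hx k) q
      rw [mul_assoc, hp, hk, mul_assoc]
  have hg : ∀ k : ℕ+, pderiv k (T 1) = 0 := by
    intro k
    have h1 := LinearMap.congr_fun (hd k) 1
    change T (pderiv k 1) = pderiv k (T 1) at h1
    rw [pderiv_one, map_zero] at h1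
    exact h1.symm
  refine LinearMap.ext fun q => ?_
  have hq : T q = q * T 1 := by rw [← hmul, mul_one]
  rw [LinearMap.smul_apply, Module.End.one_apply, hq]
  conv_lhs => rw [eq_C_of_pderiv_eq_zero hunit hg]
  rw [mul_comm, C_mul']

/-- In a `ℂ`-algebra the positive integers are units. [folklore] -/
theorem isUnit_natCast [Algebra ℂ R] (n : ℕ) (hn : 0 < n) : IsUnit (n : R) := by
  rw [← map_natCast (algebraMap ℂ R) n]
  exact (IsUnit.mk0 (n : ℂ) (by exact_mod_cast hn.ne')).map _

/-! ### The defect `[L_m, L_n] - (m - n) L_{m+n}` commutes with the Heisenberg algebra -/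

section Virasoro

variable [Algebra ℂ R] (lam mu : R)

variable (R) in
/-- The defect `C_{m,n} = L_m L_n - L_n L_m - (m - n) L_{m+n}` (to be shown a scalar, the central
term). [cite: IoharaKoga2011, Proposition 4.1] -/
def defect (m n : ℤ) : Module.End R (Space R) :=
  L R lam mu m * L R lam mu n - L R lam mu n * L R lam mu m - ((m - n : ℤ) : R) • L R lam mu (m + n)

variable (R) in
/-- The value `B_{n,j} = [L_n, a_j] = -j a_{n+j} - λ n(n+1) δ_{n+j,0}`. [cite: IoharaKoga2011, Lemma 4.4] -/
def B (n j : ℤ) : Module.End R (Space R) :=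
  (-(j : R)) • a R mu (n + j) - (if n + j = 0 then lam * n * (n + 1) else 0) • 1

/-- `L_n a_j - a_j L_n = B_{n,j}`. [cite: IoharaKoga2011, Lemma 4.4] -/
theorem L_mul_a_sub (n j : ℤ) : L R lam mu n * a R mu j - a R mu j * L R lam mu n = B R lam mu n j :=
  lie_L_a lam mu n j

/-- `L_m B_{n,j} - B_{n,j} L_m = -j B_{m,n+j}` (the scalar part of `B` commutes). [folklore] -/
theorem L_mul_B_sub (m n j : ℤ) :
    L R lam mu m * B R lam mu n j - B R lam mu n j * L R lam mu m = (-(j : R)) • B R lam mu m (n + j) := by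
  rw [← L_mul_a_sub lam mu m (n + j), B, mul_sub, sub_mul, mul_smul_comm, smul_mul_assoc,
    mul_smul_comm, smul_mul_assoc, mul_one, one_mul, smul_sub]
  abel

/-- **The defect commutes with the Heisenberg generators**: by the Jacobi identity
`[C_{m,n}, a_j] = -j B_{m,n+j} + j B_{n,m+j} - (m-n) B_{m+n,j}`, whose `a_{m+n+j}`-coefficient
`j(n+j) - j(m+j) + j(m-n)` and scalar part `λ δ (j m(m+1) - j n(n+1) + (m-n)(m+n)(m+n+1))`
(`j = -(m+n)`) both vanish. [cite: IoharaKoga2011, Proposition 4.1 (proof: "by direct computation")] -/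
theorem defect_mul_a (m n j : ℤ) :
    defect R lam mu m n * a R mu j = a R mu j * defect R lam mu m n := by
  have hA : ∀ S T : Module.End R (Space R),
      S * T * a R mu j - a R mu j * (S * T) =
        S * (T * a R mu j - a R mu j * T) + (S * a R mu j - a R mu j * S) * T := by
    intro S T
    simp only [mul_sub, sub_mul, mul_assoc]
    abel
  rw [← sub_eq_zero]
  have e1 : defect R lam mu m n * a R mu j - a R mu j * defect R lam mu m n =
      (L R lam mu m * B R lam mu n j - B R lam mu n j * L R lam mu m) -
      (L R lam mu n * B R lam mu m j - B R lam mu m j * L R lam mu n) -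
      ((m - n : ℤ) : R) • B R lam mu (m + n) j := by
    rw [← L_mul_a_sub lam mu (m + n) j, ← L_mul_a_sub lam mu m j, ← L_mul_a_sub lam mu n j, defect]
    simp only [sub_mul, mul_sub, smul_mul_assoc, mul_smul_comm, smul_sub, mul_assoc]
    abel
  rw [e1, L_mul_B_sub, L_mul_B_sub, B, B, B]
  have i1 : m + (n + j) = m + n + j := by ring
  have i2 : n + (m + j) = m + n + j := by ring
  simp only [i1, i2]
  by_cases h : m + n + j = 0
  · have hj : j = -(m + n) := by omega
    subst hj
    simp only [h, if_true]
    push_cast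
    module
  · simp only [h, if_false]
    push_cast
    module

/-- Hence the defect is a scalar operator. [cite: IoharaKoga2011, Proposition 4.1] -/
theorem defect_eq_smul_one (m n : ℤ) :
    defect R lam mu m n = coeff 0 (defect R lam mu m n 1) • (1 : Module.End R (Space R)) := by
  refine eq_smul_one_of_forall_commute isUnit_natCast _ (fun k => ?_) (fun k => ?_)
  · rw [← a_neg mu k, defect_mul_a]
  · have h1 := defect_mul_a lam mu m n k
    rw [a_pos, mul_smul_comm, smul_mul_assoc] at h1
    exact (isUnit_natCast (R := R) k k.pos).smul_left_cancel.mp h1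

/-! ### Evaluations on the vacuum -/

omit [Algebra ℂ R] in
/-- The annihilation part kills constants. [folklore] -/
theorem aa_apply_C [Algebra ℂ R] (N : ℕ) (r : R) : aa R N (C r) = 0 := by
  simp [aa]

/-- `quad 0 = 0` (empty sum: `x_0 = 0`). [folklore] -/
theorem quad_zero : quad R 0 = 0 := by simp [quad]

/-- `P_n = 0` for `n ≥ 0`. [folklore] -/
theorem P_of_nonneg {n : ℤ} (hn : 0 ≤ n) : P R lam mu n = 0 := by
  have h : (-n).toNat = 0 := by omega
  simp [P, h, quad_zero]

/-- `A_0 = 0`. [folklore] -/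
theorem aa_zero : aa R 0 = 0 := by simp [aa]

/-- `L_n |μ⟩ = P_n + δ_{n,0} h`. [cite: IoharaKoga2011, Proposition 4.1 (2)] -/
theorem L_apply_one (n : ℤ) :
    L R lam mu n 1 = P R lam mu n + C (if n = 0 then hval R lam mu else 0) := by
  simp only [L, LinearMap.add_apply, LinearMap.mulLeft_apply, mul_one, Derivation.coeFn_coe,
    Derivation.map_one_eq_zero, add_zero, LinearMap.smul_apply, Module.End.one_apply]
  rw [← C_1, aa_apply_C, add_zero, C_1, MvPolynomial.smul_eq_C_mul, mul_one]

/-- `L_n |μ⟩ = 0` for `n > 0` (the vacuum is annihilated by `Vir⁺`). [cite: IoharaKoga2011, Proposition 4.1 (2)] -/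
theorem L_pos_one {n : ℤ} (hn : 0 < n) : L R lam mu n 1 = 0 := by
  rw [L_apply_one, P_of_nonneg lam mu hn.le, if_neg hn.ne', C_0, add_zero]

/-- `L_0 |μ⟩ = h |μ⟩`, `h = ½μ² - λμ`. [cite: IoharaKoga2011, Proposition 4.1 (2) and eq. (4.4)] -/
theorem L_zero_one : L R lam mu 0 1 = C (hval R lam mu) := by
  rw [L_apply_one, P_of_nonneg lam mu le_rfl, if_pos rfl, zero_add]

/-- `L_{-K} |μ⟩ = P_{-K}`. [cite: IoharaKoga2011, Proposition 4.1] -/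
theorem L_neg_one {n : ℤ} (hn : n < 0) : L R lam mu n 1 = P R lam mu n := by
  rw [L_apply_one, if_neg hn.ne, C_0, add_zero]

omit [Algebra ℂ R] in
/-- `D_0` is the Euler (level) derivation: `D_0 x_k = k x_k`. [folklore] -/
theorem D_zero_x (k : ℕ) : D R lam mu 0 (x R k) = (k : R) • x R k := by
  rw [D_x]
  have h : ((k : ℤ) - 0).toNat = k := by simp
  rw [h]
  split_ifs with h0
  · have hk : k = 0 := by exact_mod_cast h0.symm
    subst hk
    simp
  · rw [add_zero]

/-- `D_0` multiplies the level-`K` creation polynomial by `K`. [folklore] -/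
theorem D_zero_apply_P (n : ℤ) : D R lam mu 0 (P R lam mu n) = (((-n).toNat : ℕ) : R) • P R lam mu n := by
  set K := (-n).toNat with hK
  have hterm : ∀ i ∈ Finset.range (K + 1),
      D R lam mu 0 (x R i * x R (K - i)) = (K : R) • (x R i * x R (K - i)) := by
    intro i hi
    rw [Finset.mem_range] at hi
    rw [Derivation.leibniz, D_zero_x, D_zero_x, smul_comm (x R i), smul_comm (x R (K - i)),
      smul_eq_mul, smul_eq_mul, mul_comm (x R (K - i)) (x R i), ← add_smul, Nat.cast_sub (by omega),
      sub_add_cancel]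
  have hquad : D R lam mu 0 (quad R K) = (K : R) • quad R K := by
    rw [quad, Derivation.map_smul, map_sum, Finset.sum_congr rfl hterm, ← Finset.smul_sum, smul_smul,
      smul_smul, mul_comm]
  rw [P, map_add, Derivation.map_smul, hquad, D_zero_x, smul_add, smul_comm]

/-- `L_0 P_n = (h - n) P_n` (`P_n = L_n|μ⟩` has level `-n`). [cite: IoharaKoga2011, §4.2.1 (grading of F^η)] -/
theorem L_zero_apply_P (n : ℤ) :
    L R lam mu 0 (P R lam mu n) = ((((-n).toNat : ℕ) : R) + hval R lam mu) • P R lam mu n := by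
  simp only [L, LinearMap.add_apply, LinearMap.mulLeft_apply, Derivation.coeFn_coe, if_true,
    LinearMap.smul_apply, Module.End.one_apply, Int.toNat_zero, aa_zero,
    P_of_nonneg lam mu (le_refl (0 : ℤ)), zero_mul, zero_add, D_zero_apply_P, add_smul, add_zero]

variable (R) in
/-- `S_M = Σ_{i=0}^{M} i (M - i)` (`= (M³ - M)/6`). [folklore] -/
def S (M : ℕ) : R := ∑ i ∈ Finset.range (M + 1), (i : R) * ((M : R) - i)

omit [Algebra ℂ R] in
/-- `6 Σ_{i=0}^{M} i (M - i) = M³ - M`. [folklore] -/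
theorem six_mul_S (M : ℕ) : 6 * S R M = (M : R) ^ 3 - M := by
  induction M with
  | zero => simp [S]
  | succ M ih =>
    have h1 : S R (M + 1) = S R M + ∑ i ∈ Finset.range (M + 1), (i : R) := by
      rw [S, S, Finset.sum_range_succ, ← Finset.sum_add_distrib]
      push_cast
      have : ((M : R) + 1 - (M + 1)) = 0 := by ring
      rw [this, mul_zero, add_zero]
      refine Finset.sum_congr rfl fun i _ => ?_
      ring
    have h2nat := Finset.sum_range_id_mul_two (M + 1)
    rw [Nat.add_sub_cancel] at h2nat
    have h2 : (∑ i ∈ Finset.range (M + 1), (i : R)) * 2 = ((M + 1 : ℕ) : R) * M := by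
      have := congrArg (Nat.cast (R := R)) h2nat
      push_cast at this ⊢
      exact this
    rw [h1, mul_add, ih]
    push_cast at h2 ⊢
    linear_combination 3 * h2

/-- `D_M` kills the level-`M` quadratic creation polynomial (its variables `x_i`, `i < M`, are sent
to `i x_{i-M} = 0`). [folklore] -/
theorem D_apply_quad_self (M : ℕ) : D R lam mu M (quad R M) = 0 := by
  rw [quad, Derivation.map_smul, map_sum]
  have : ∀ i ∈ Finset.range (M + 1), D R lam mu M (x R i * x R (M - i)) = 0 := by
    intro i hi
    rw [Finset.mem_range] at hi
    have hDx : ∀ j : ℕ, j < M → D R lam mu (M : ℤ) (x R j) = 0 := by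
      intro j hj
      rw [D_x]
      have e : ((j : ℤ) - M).toNat = 0 := by omega
      rw [e, x_zero, smul_zero, zero_add, if_neg (by omega)]
    rcases Nat.eq_zero_or_pos i with rfl | hi0
    · rw [x_zero, zero_mul, map_zero]
    · rw [Derivation.leibniz, hDx (M - i) (by omega), smul_zero, zero_add]
      rcases eq_or_lt_of_le (Nat.lt_succ_iff.mp hi) with rfl | hlt
      · rw [Nat.sub_self, x_zero, zero_smul]
      · rw [hDx i hlt, smul_zero]
  rw [Finset.sum_congr rfl this, Finset.sum_const_zero, smul_zero]

/-- `A_M` sends the level-`M` quadratic creation polynomial to the constant `½ S_M`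
(`∂_i ∂_{M-i} (½ Σ x_a x_{M-a}) = 1`). [folklore] -/
theorem aa_apply_quad_self (M : ℕ) : aa R M (quad R M) = C (half R * S R M) := by
  rw [aa, LinearMap.sum_apply, S, Finset.mul_sum, map_sum]
  refine Finset.sum_congr rfl fun i hi => ?_
  rw [Finset.mem_range] at hi
  rw [LinearMap.smul_apply, Module.End.mul_apply, Derivation.coeFn_coe, Derivation.coeFn_coe,
    MvPolynomial.smul_eq_C_mul, ← mul_assoc]
  rcases Nat.eq_zero_or_pos i with rfl | hi0
  · simp
  · rcases eq_or_lt_of_le (Nat.lt_succ_iff.mp hi) with rfl | hlt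
    · simp
    · have e : M - (M - i) = i := by omega
      rw [d_quad _ _ (by omega), e, d_x, if_pos ⟨rfl, hi0⟩, mul_one]

/-- `A_M x_M = 0` (`∂_i ∂_{M-i} x_M = 0`). [folklore] -/
theorem aa_apply_x_self (M : ℕ) : aa R M (x R M) = 0 := by
  rw [aa, LinearMap.sum_apply]
  refine Finset.sum_eq_zero fun i _ => ?_
  rw [LinearMap.smul_apply, Module.End.mul_apply, Derivation.coeFn_coe, Derivation.coeFn_coe, d_x]
  split_ifs <;> simp

/-- **`L_M L_{-M} |μ⟩ = M (μ - λ(1-M)) (μ - λ(M+1)) + ½ S_M`** for `M ≥ 1` (a multiple of the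
vacuum: the terms `a_0 a_M · a_{-M} a_0`, `λ² (M+1)(1-M) a_M a_{-M}` and `¼ Σ a_i a_{M-i} a_{-j} a_{-(M-j)}`).
[cite: IoharaKoga2011, Proposition 4.1 (proof) and eq. (4.2)] -/
theorem L_pos_apply_P (M : ℕ) (hM : 0 < M) :
    L R lam mu M (P R lam mu (-(M : ℤ))) =
      C ((mu - lam * (1 + -(M : ℤ))) * ((mu - lam * ((M : ℤ) + 1)) * M) + half R * S R M) := by
  have hP : P R lam mu (-(M : ℤ)) = quad R M + (mu - lam * (1 + -(M : ℤ))) • x R M := by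
    simp [P]
  have hM0 : (M : ℤ) ≠ 0 := by exact_mod_cast hM.ne'
  have e : ((M : ℤ) - M).toNat = 0 := by simp
  simp only [L, LinearMap.add_apply, LinearMap.mulLeft_apply, Derivation.coeFn_coe, hM0, if_false,
    zero_smul, add_zero, P_of_nonneg lam mu (show (0 : ℤ) ≤ M by positivity),
    zero_mul, zero_add, Int.toNat_natCast, hP, map_add, LinearMap.map_smul,
    D_apply_quad_self, aa_apply_quad_self, aa_apply_x_self, smul_zero, D_x, e, x_zero, if_true]
  have hC : ∀ a b c : R, C a + c • C b = (C (c * b + a) : Space R) := by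
    intro a b c
    rw [MvPolynomial.smul_eq_C_mul, ← C_mul, ← C_add, add_comm]
  rw [hC, ← C_add]
  congr 1
  push_cast
  ring

variable (R) in
/-- `1/12 ∈ R`. [folklore] -/
def twelfth : R := algebraMap ℂ R 12⁻¹

/-- `12 · (1/12) = 1`. [folklore] -/
theorem twelve_mul_twelfth : (12 : R) * twelfth R = 1 := by
  rw [twelfth, ← map_ofNat (algebraMap ℂ R) 12, ← map_mul, mul_inv_cancel₀ (by norm_num), map_one]

/-- `½ = 6/12`. [folklore] -/
theorem half_eq_six_mul_twelfth : half R = 6 * twelfth R := by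
  rw [half, twelfth, ← map_ofNat (algebraMap ℂ R) 6, ← map_mul]
  congr 1
  norm_num

/-- The vacuum expectation of the defect `C_{M,-M}`, `M ≥ 1`:
`⟨μ| [L_M, L_{-M}] - 2M L_0 |μ⟩ = (c_λ/12)(M³ - M)` with `c_λ = 1 - 12λ²`.
[cite: IoharaKoga2011, Proposition 4.1 and eq. (4.2)] -/
theorem coeff_zero_defect_self (M : ℕ) (hM : 0 < M) :
    coeff 0 (defect R lam mu M (-(M : ℤ)) 1) = (1 - 12 * lam ^ 2) * twelfth R * ((M : R) ^ 3 - M) := by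
  have h0 : (M : ℤ) + -(M : ℤ) = 0 := by ring
  rw [defect, LinearMap.sub_apply, LinearMap.sub_apply, Module.End.mul_apply, Module.End.mul_apply,
    L_pos_one lam mu (by exact_mod_cast hM : (0 : ℤ) < M), map_zero, sub_zero,
    L_neg_one lam mu (by omega : -(M : ℤ) < 0), L_pos_apply_P lam mu M hM, LinearMap.smul_apply, h0,
    L_zero_one, MvPolynomial.coeff_sub, coeff_C, if_pos rfl, coeff_smul, coeff_C, if_pos rfl,
    smul_eq_mul, hval]
  have h1 := two_mul_half (R := R)
  have h2 := six_mul_S (R := R) M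
  have h3 := half_eq_six_mul_twelfth (R := R)
  push_cast
  linear_combination (-((M : R) * mu ^ 2) + lam ^ 2 * ((M : R) ^ 3 - M)) * h1 + twelfth R * h2 +
    (S R M - 2 * lam ^ 2 * ((M : R) ^ 3 - M)) * h3

/-- The defect `C_{0,k}` vanishes on the vacuum. [folklore] -/
theorem defect_zero_apply_one (k : ℤ) : defect R lam mu 0 k 1 = 0 := by
  rw [defect, LinearMap.sub_apply, LinearMap.sub_apply, Module.End.mul_apply, Module.End.mul_apply,
    LinearMap.smul_apply, zero_add, L_zero_one, MvPolynomial.C_eq_smul_one, LinearMap.map_smul]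
  rcases lt_trichotomy k 0 with hk | rfl | hk
  · rw [L_neg_one lam mu hk, L_zero_apply_P]
    have e : ((0 - k : ℤ) : R) = (((-k).toNat : ℕ) : R) := by
      have : (0 - k : ℤ) = ((-k).toNat : ℤ) := by omega
      rw [this]; push_cast; rfl
    rw [e]
    module
  · rw [sub_self, Int.cast_zero, zero_smul, sub_zero, L_zero_one, MvPolynomial.C_eq_smul_one,
      LinearMap.map_smul, L_zero_one, MvPolynomial.C_eq_smul_one, sub_self]
  · rw [L_pos_one lam mu hk, smul_zero, smul_zero, sub_zero, map_zero, sub_zero]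

/-- **`[L_0, L_k] = -k L_k`** on the Fock space. [cite: IoharaKoga2011, Proposition 4.1] -/
theorem L_zero_comm (k : ℤ) :
    L R lam mu 0 * L R lam mu k = L R lam mu k * L R lam mu 0 + (-(k : R)) • L R lam mu k := by
  have h := defect_eq_smul_one lam mu 0 k
  rw [defect_zero_apply_one, coeff_zero, zero_smul, defect, sub_eq_zero, sub_eq_iff_eq_add, zero_add]
    at h
  rw [h]
  push_cast
  rw [zero_sub, add_comm]

/-- The defect has `L_0`-degree `-(m+n)`: `[L_0, C_{m,n}] = -(m+n) C_{m,n}`. [folklore] -/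
theorem L_zero_mul_defect_sub (m n : ℤ) :
    L R lam mu 0 * defect R lam mu m n - defect R lam mu m n * L R lam mu 0 =
      (-((m + n : ℤ) : R)) • defect R lam mu m n := by
  have h1 := L_zero_comm lam mu m
  have h2 := L_zero_comm lam mu n
  have h3 := L_zero_comm lam mu (m + n)
  have h1' : ∀ T : Module.End R (Space R), L R lam mu 0 * (L R lam mu m * T) =
      L R lam mu m * (L R lam mu 0 * T) + (-(m : R)) • (L R lam mu m * T) := by
    intro T; rw [← mul_assoc, h1, add_mul, mul_assoc, smul_mul_assoc]
  have h2' : ∀ T : Module.End R (Space R), L R lam mu 0 * (L R lam mu n * T) =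
      L R lam mu n * (L R lam mu 0 * T) + (-(n : R)) • (L R lam mu n * T) := by
    intro T; rw [← mul_assoc, h2, add_mul, mul_assoc, smul_mul_assoc]
  simp only [defect, mul_sub, sub_mul, mul_assoc, mul_smul_comm, smul_mul_assoc, h1', h2', h1, h2, h3,
    mul_add, smul_add, smul_sub, smul_smul]
  push_cast
  module

/-- **The Virasoro relations for the Feigin–Fuchs operators**:
`L_m L_n - L_n L_m = (m - n) L_{m+n} + (c_λ/12)(m³ - m) δ_{m+n,0}`, `c_λ = 1 - 12λ²`, on the Fock
space `R[x₁, x₂, …]` (any commutative `ℂ`-algebra `R`, any `λ, μ ∈ R`).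
[cite: IoharaKoga2011, Proposition 4.1 (1) with eq. (4.2)] -/
theorem L_comm (m n : ℤ) :
    L R lam mu m * L R lam mu n - L R lam mu n * L R lam mu m =
      ((m - n : ℤ) : R) • L R lam mu (m + n) +
        (if m + n = 0 then (1 - 12 * lam ^ 2) * twelfth R * ((m : R) ^ 3 - m) else 0) • 1 := by
  -- the defect is the scalar `γ`
  suffices hdef : defect R lam mu m n =
      (if m + n = 0 then (1 - 12 * lam ^ 2) * twelfth R * ((m : R) ^ 3 - m) else 0) • 1 by
    rw [defect, sub_eq_iff_eq_add] at hdef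
    rw [hdef, add_comm]
  -- positive-level case, from the vacuum expectation
  have hpos : ∀ M : ℕ, 0 < M → defect R lam mu M (-(M : ℤ)) =
      ((1 - 12 * lam ^ 2) * twelfth R * ((M : R) ^ 3 - M)) • 1 := by
    intro M hM
    rw [defect_eq_smul_one, coeff_zero_defect_self lam mu M hM]
  by_cases hmn : m + n = 0
  · rw [if_pos hmn]
    rcases lt_trichotomy m 0 with hm | rfl | hm
    · -- `m < 0`: antisymmetry
      obtain ⟨M, rfl⟩ : ∃ M : ℕ, n = M := ⟨n.toNat, by omega⟩
      have hm' : m = -(M : ℤ) := by omega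
      subst hm'
      have hanti : defect R lam mu (-(M : ℤ)) M = -defect R lam mu M (-(M : ℤ)) := by
        simp only [defect]
        rw [show (-(M : ℤ)) + M = M + -(M : ℤ) by ring]
        push_cast
        module
      rw [hanti, hpos M (by omega)]
      push_cast
      module
    · have hn : n = 0 := by omega
      subst hn
      simp [defect]
    · obtain ⟨M, rfl⟩ : ∃ M : ℕ, m = M := ⟨m.toNat, by omega⟩
      have hn : n = -(M : ℤ) := by omega
      subst hn
      rw [hpos M (by exact_mod_cast hm)]
      push_cast
      rfl
  · -- `m + n ≠ 0`: the scalar has non-zero `L_0`-degree, hence vanishes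
    rw [if_neg hmn, zero_smul]
    have hγ := defect_eq_smul_one lam mu m n
    set γ := coeff 0 (defect R lam mu m n 1) with hγ_def
    have hX := L_zero_mul_defect_sub lam mu m n
    rw [hγ, mul_smul_comm, smul_mul_assoc, mul_one, one_mul, sub_self, smul_smul] at hX
    have hX1 := LinearMap.congr_fun hX (1 : Space R)
    rw [LinearMap.zero_apply, LinearMap.smul_apply, Module.End.one_apply,
      MvPolynomial.smul_eq_C_mul, mul_one, eq_comm, C_eq_zero] at hX1
    have hunit : IsUnit (-((m + n : ℤ) : R)) := by
      rw [← map_intCast (algebraMap ℂ R), ← map_neg]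
      exact (IsUnit.mk0 _ (neg_ne_zero.mpr (by exact_mod_cast hmn))).map _
    rw [hunit.mul_right_eq_zero] at hX1
    rw [hγ, hX1, zero_smul]

/-! ### The Fock representation -/

/-- **The Fock module `F_λ^μ`** (`λ ∈ ℂ`, `μ ∈ R`): the Feigin–Fuchs operators form a
representation of the Virasoro algebra of central charge `c_λ = 1 - 12λ²` on the `ℂ`-vector space
`R[x₁, x₂, …]`. [cite: IoharaKoga2011, Proposition 4.1 and eq. (4.2) (F^η_λ)] -/
def rep (lam : ℂ) (mu : R) : VirasoroRep (1 - 12 * lam ^ 2) (Space R) where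
  L n := (L R (algebraMap ℂ R lam) mu n).restrictScalars ℂ
  lie m n v := by
    have h := LinearMap.congr_fun (L_comm (algebraMap ℂ R lam) mu m n) v
    simp only [LinearMap.sub_apply, Module.End.mul_apply, LinearMap.add_apply, LinearMap.smul_apply,
      Module.End.one_apply] at h
    simp only [LinearMap.restrictScalars_apply]
    rw [h]
    congr 1
    · rw [← algebraMap_smul (A := R) ((m : ℂ) - n)]
      congr 1
      simp
    · rw [← algebraMap_smul (A := R) (centralTerm (1 - 12 * lam ^ 2) m n), centralTerm]
      congr 1
      by_cases h0 : m + n = 0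
      · rw [if_pos h0, if_pos h0]
        simp only [map_mul, map_sub, map_one, map_pow, div_eq_mul_inv, twelfth, map_ofNat,
          map_intCast]
      · rw [if_neg h0, if_neg h0, map_zero]

/-- The generators of the Fock module are the Feigin–Fuchs operators. [folklore] -/
theorem rep_L_apply (lam : ℂ) (mu : R) (n : ℤ) (v : Space R) :
    (rep lam mu).L n v = L R (algebraMap ℂ R lam) mu n v := rfl

end Virasoro

/-- **The vacuum of `F_λ^μ` (`λ, μ ∈ ℂ`) is a primary vector of weight `h = ½ μ (μ - 2λ)`.**
[cite: IoharaKoga2011, Proposition 4.1 (2) and eq. (4.4)] -/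
theorem isPrimary_one (lam mu : ℂ) : (rep (R := ℂ) lam mu).IsPrimary 1 (mu * (mu - 2 * lam) / 2) := by
  refine ⟨fun n hn => ?_, ?_⟩
  · rw [rep_L_apply, Algebra.algebraMap_self_apply, L_pos_one lam mu hn]
  · rw [rep_L_apply, Algebra.algebraMap_self_apply, L_zero_one, MvPolynomial.smul_eq_C_mul, mul_one,
      hval, half, Algebra.algebraMap_self_apply]
    congr 1
    ring

/-! ### Creation operators have no vacuum component -/

section Vacuum

variable [Algebra ℂ R] (lam mu : R)

omit [Algebra ℂ R] in
/-- `x_k` has no constant term. [folklore] -/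
theorem constantCoeff_x (k : ℕ) : constantCoeff (x R k) = 0 := by
  rcases Nat.eq_zero_or_pos k with rfl | hk
  · simp
  · rw [x_of_pos hk, constantCoeff_X]

/-- `P_n` has no constant term (also for `n ≥ 0`, when `P_n = 0`). [folklore] -/
theorem constantCoeff_P (n : ℤ) : constantCoeff (P R lam mu n) = 0 := by
  rw [P, map_add, quad, MvPolynomial.smul_eq_C_mul, map_mul, map_sum, MvPolynomial.smul_eq_C_mul,
    map_mul, constantCoeff_x, mul_zero, add_zero]
  have : ∀ i ∈ Finset.range ((-n).toNat + 1), constantCoeff (x R i * x R ((-n).toNat - i)) = 0 := by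
    intro i _
    rw [map_mul, constantCoeff_x, zero_mul]
  rw [Finset.sum_congr rfl this, Finset.sum_const_zero, mul_zero]

omit [Algebra ℂ R] in
/-- The derivation part of `L_n`, `n < 0`, produces no constant term. [folklore] -/
theorem constantCoeff_D {n : ℤ} (hn : n < 0) (q : Space R) : constantCoeff (D R lam mu n q) = 0 := by
  induction q using MvPolynomial.induction_on with
  | C r => rw [derivation_C, map_zero]
  | add p q hp hq => rw [map_add, map_add, hp, hq, add_zero]
  | mul_X p i hp =>
    rw [Derivation.leibniz, map_add, smul_eq_mul, smul_eq_mul, map_mul, map_mul, hp, mul_zero,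
      add_zero, ← x_coe, D_x, map_add, MvPolynomial.smul_eq_C_mul,
      map_mul, constantCoeff_x, mul_zero, zero_add, if_neg (by have := i.pos; omega), map_zero, mul_zero]

/-- **`⟨μ| L_{-k} = 0`**: for `k ≥ 1` the vector `L_{-k} v` has no component along the vacuum
(`L_{-k}` raises the level by `k`). [cite: IoharaKoga2011, §4.2.1 (F^η = ⊕ₙ (F^η)^{-nα}, L₋ₖ of degree k)] -/
theorem constantCoeff_L_neg {n : ℤ} (hn : n < 0) (q : Space R) :
    constantCoeff (L R lam mu n q) = 0 := by
  have h0 : n.toNat = 0 := by omega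
  simp only [L, LinearMap.add_apply, LinearMap.mulLeft_apply, Derivation.coeFn_coe, h0, aa_zero,
    add_zero, if_neg hn.ne, zero_smul, map_add, map_mul,
    constantCoeff_P lam mu n, zero_mul, constantCoeff_D lam mu hn]

end Vacuum

/-! ### Base change -/

section BaseChange

variable {S' : Type*} [CommRing S'] [Algebra ℂ R] [Algebra ℂ S'] (φ : R →ₐ[ℂ] S') (lam mu : R)

/-- Base change of `x_k`. [folklore] -/
theorem map_x (k : ℕ) : MvPolynomial.map (φ : R →+* S') (x R k) = x S' k := by
  rcases Nat.eq_zero_or_pos k with rfl | hk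
  · simp
  · rw [x_of_pos hk, x_of_pos hk, map_X]

/-- `φ(½) = ½`. [folklore] -/
theorem map_half : φ (half R) = half S' := AlgHom.commutes φ _

/-- `φ(1/12) = 1/12`. [folklore] -/
theorem map_twelfth : φ (twelfth R) = twelfth S' := AlgHom.commutes φ _

/-- Base change of the quadratic creation polynomial. [folklore] -/
theorem map_quad (N : ℕ) : MvPolynomial.map (φ : R →+* S') (quad R N) = quad S' N := by
  rw [quad, quad, MvPolynomial.smul_eq_C_mul, map_mul, map_C, map_sum, MvPolynomial.smul_eq_C_mul]
  simp only [map_mul, map_x, RingHom.coe_coe, map_half]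

/-- Base change of `P_n`. [folklore] -/
theorem map_P (n : ℤ) : MvPolynomial.map (φ : R →+* S') (P R lam mu n) = P S' (φ lam) (φ mu) n := by
  rw [P, P, map_add, map_quad, MvPolynomial.smul_eq_C_mul, map_mul, map_C, map_x,
    MvPolynomial.smul_eq_C_mul]
  simp

/-- Base change commutes with `∂_k`. [folklore] -/
theorem map_d (k : ℕ) (q : Space R) : MvPolynomial.map (φ : R →+* S') (d R k q) = d S' k (MvPolynomial.map (φ : R →+* S') q) := by
  rcases Nat.eq_zero_or_pos k with rfl | hk
  · simp
  · rw [d_of_pos hk, d_of_pos hk, pderiv_map]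

omit [Algebra ℂ R] [Algebra ℂ S'] in
/-- Base change of the values of the derivation part. [folklore] -/
theorem map_dc (φ' : R →+* S') (n : ℤ) (i : ℕ+) :
    MvPolynomial.map φ' (dc R lam mu n i) = dc S' (φ' lam) (φ' mu) n i := by
  rw [dc, dc, map_add, MvPolynomial.smul_eq_C_mul, map_mul, map_C, MvPolynomial.smul_eq_C_mul,
    map_natCast]
  congr 1
  · rcases Nat.eq_zero_or_pos (((i : ℕ) : ℤ) - n).toNat with h | h
    · rw [h]; simp
    · rw [x_of_pos h, x_of_pos h, map_X]
  · split_ifs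
    · rw [map_C]; simp
    · rw [map_zero]

omit [Algebra ℂ R] [Algebra ℂ S'] in
/-- Base change commutes with the derivation part. [folklore] -/
theorem map_D (φ' : R →+* S') (n : ℤ) (q : Space R) :
    MvPolynomial.map φ' (D R lam mu n q) = D S' (φ' lam) (φ' mu) n (MvPolynomial.map φ' q) := by
  induction q using MvPolynomial.induction_on with
  | C r => rw [derivation_C, map_C, derivation_C, map_zero]
  | add p q hp hq => rw [map_add, map_add, hp, hq, map_add, map_add]
  | mul_X p i hp =>
    rw [Derivation.leibniz, map_add, smul_eq_mul, smul_eq_mul, map_mul, map_mul, hp, map_mul, map_X,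
      Derivation.leibniz, smul_eq_mul, smul_eq_mul, D, D, mkDerivation_X, mkDerivation_X, map_dc]

/-- Base change commutes with the annihilation part. [folklore] -/
theorem map_aa (N : ℕ) (q : Space R) :
    MvPolynomial.map (φ : R →+* S') (aa R N q) = aa S' N (MvPolynomial.map (φ : R →+* S') q) := by
  simp only [aa, LinearMap.sum_apply, LinearMap.smul_apply, Module.End.mul_apply, Derivation.coeFn_coe,
    map_sum, MvPolynomial.smul_eq_C_mul, map_mul, map_C, map_d, RingHom.coe_coe, map_natCast, map_sub,
    map_half]

/-- **Base change**: the Feigin–Fuchs operators are compatible with extension of scalars along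
`ℂ`-algebra maps `φ : R → S` (parameters `λ ↦ φ(λ)`, `μ ↦ φ(μ)`). [folklore] -/
theorem map_L (n : ℤ) (q : Space R) :
    MvPolynomial.map (φ : R →+* S') (L R lam mu n q) =
      L S' (φ lam) (φ mu) n (MvPolynomial.map (φ : R →+* S') q) := by
  simp only [L, LinearMap.add_apply, LinearMap.mulLeft_apply, Derivation.coeFn_coe, LinearMap.smul_apply,
    Module.End.one_apply, map_add, map_mul, map_P, map_aa, MvPolynomial.smul_eq_C_mul, map_C,
    RingHom.coe_coe]
  rw [map_D lam mu (φ : R →+* S') n q]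
  congr 2
  split_ifs
  · simp [hval, map_half]
  · simp

/-- Base change intertwines the Fock representations `F_λ^μ → F_λ^{φ(μ)}`. [folklore] -/
theorem map_rep_L (lam : ℂ) (n : ℤ) (q : Space R) :
    MvPolynomial.map (φ : R →+* S') ((rep lam mu).L n q) = (rep lam (φ mu)).L n (MvPolynomial.map (φ : R →+* S') q) := by
  rw [rep_L_apply, rep_L_apply, map_L, AlgHom.commutes]

end BaseChange

end Fock

end Literature.RepresentationTheory.Virasoro

end
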